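import Literature.Probability.RandomPlanarGeometry.SAWPulledFreeEnergyZ2
import Literature.Probability.RandomPlanarGeometry.SAWStripTMAtBound
import Literature.Probability.RandomPlanarGeometry.SAWStripTMAtEval3602
import HarnessLib

/-!
# The pulled-SAW free energy at force `y = 2` on `ℤ²` to four significant digits: `e^{λ_B(2)} ∈ [3.60230, 3.60301]`

Topic `Literature/Probability/RandomPlanarGeometry` (continues `SAWPulledFreeEnergyZ2.lean` — objects, the tilted
renewal engine `Renewal.exists_mul_pow_le_pulledBridgeZ`, the span-1 edition `[3.5612, 3.6030065]` and the upper
side `driftZ_two_upper` — with the certified strip transfer matrices of spans `2, …, 5` at fugacity `347/1250`,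
`SAWStripTMAtEval3602.lean`, through `StripTM.kraft_ge_at`).

Source: N. R. Beaton, J. Phys. A 48 (2015) 16FT03, Theorem 1 / Lemma 2 (strictness `λ(y) > log μ` for `y > 1`; no
value printed). Method of the lower side: Kesten (1963) §4 / Jensen (2004) §2 irreducible-bridge certificates, here
with the span weight `y^{span}`.

## What is new in this file (not in print)

`pulledBridgeZ_two_lower_sharp : ∃ κ > 0, ∀ N, κ·(1250/347)^N ≤ Z^B_N(2)` (`1250/347 = 3.602305…`): the tilted Kraft
sum over the span-1 family and the span-2…5 irreducible bridges of the `l × 81` windows is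
`0.98190 + 4·0.0038219 + 8·0.00031722 + 16·0.0000296644 + 32·0.0000029904 = 1.00029 ≥ 1` (exact rational
`norm_num`). With `driftZ_two_upper` (`Z_N(log 2) ≤ 2⁴¹·3.6030065^N`): **`3.60230 ≤ e^{λ_B(2)} ≤ e^{λ(2)} ≤ 3.60301`**
whenever the limits exist (`pulled_enclosure_two_sharp` is the finite-`N` statement). Axioms: standard + the declared
`native_decide` evaluations `StripTM.dpAt_{two,…,five}_3602` (lower side) and `FiniteMemory.checkW_16_2_1` (upper).
(Lane «pcv-sawmu» item X26 «PULL-ENCL», kernel edition with spans ≤ 5.)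
-/

noncomputable section

open Finset Literature.Probability.LatticeModels
open scoped BigOperators

namespace Literature.Probability.RandomPlanarGeometry.SAW

/-- Adding a set of bridges of a new span keeps a tilted Kraft sum additive. [folklore] -/
private theorem sum_union_of_xEnd' {A B : Finset (List Step)} {n : ℤ} (hA : ∀ s ∈ A, xEnd s < n)
    (hB : ∀ s ∈ B, xEnd s = n) (f : List Step → ℝ) : ∑ s ∈ A ∪ B, f s = ∑ s ∈ A, f s + ∑ s ∈ B, f s := by
  apply sum_union
  rw [Finset.disjoint_left]
  intro s ha hb
  have := hA s ha; rw [hB s hb] at this; exact lt_irrefl _ this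

/-- The certified span contributions at fugacity `347/1250`, weighted by `2^{span}`.
[cite: Jensen2004SAWLowerBounds, §2] -/
theorem dpAt_values_3602_tilted :
    (4 : ℝ) * (StripTM.dpAt 347 1250 2 40 (2 ^ 64) 81 : ℝ) + 8 * StripTM.dpAt 347 1250 3 40 (2 ^ 64) 81 +
      16 * StripTM.dpAt 347 1250 4 40 (2 ^ 64) 81 + 32 * StripTM.dpAt 347 1250 5 40 (2 ^ 64) 81 =
      339339242946921756 := by
  rw [StripTM.dpAt_two_3602, StripTM.dpAt_three_3602, StripTM.dpAt_four_3602, StripTM.dpAt_five_3602]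
  norm_num

/-- The numerical heart: `2·(span-1 Kraft sum at 347/1250) + 339339242946921756/2⁶⁴ ≥ 1` (`= 1.00029…`).
[cite: Jensen2004SAWLowerBounds, §2] -/
theorem tiltedKraft_numeric_3602 :
    (1 : ℝ) ≤ 2 * (∑ k ∈ Finset.range 61, (347 / 1250 : ℝ) ^ (k + 1) + ∑ k ∈ Finset.range 60, (347 / 1250 : ℝ) ^ (k + 2)) +
      339339242946921756 / 2 ^ 64 := by
  have h1 : ∑ k ∈ Finset.range 61, (347 / 1250 : ℝ) ^ (k + 1) =
      347 / 1250 * ∑ k ∈ Finset.range 61, (347 / 1250 : ℝ) ^ k := by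
    rw [mul_sum]; refine sum_congr rfl fun k _ => by ring
  have h2 : ∑ k ∈ Finset.range 60, (347 / 1250 : ℝ) ^ (k + 2) =
      (347 / 1250) ^ 2 * ∑ k ∈ Finset.range 60, (347 / 1250 : ℝ) ^ k := by
    rw [mul_sum]; refine sum_congr rfl fun k _ => by ring
  rw [h1, h2, geom_sum_eq (by norm_num), geom_sum_eq (by norm_num)]
  norm_num

/-- **Lower side at `y = 2`, sharp edition**: `∃ κ > 0, ∀ N, κ·(1250/347)^N ≤ Z^B_N(2)` on `ℤ²`
(`1250/347 = 3.602305…`). [cite: Beaton2015, Lemma 2; Jensen2004SAWLowerBounds, §2, eq. (4)] -/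
theorem pulledBridgeZ_two_lower_sharp :
    ∃ κ : ℝ, 0 < κ ∧ ∀ N : ℕ, κ * (1250 / 347 : ℝ) ^ N ≤ Zd.pulledBridgeZ 2 N 2 := by
  have hq : (347 : ℕ) ≤ 1250 := by norm_num
  obtain ⟨S2, hS2, hK2⟩ := StripTM.kraft_ge_at (l := 2) (r0 := 40) le_rfl hq (2 ^ 64) 81
  obtain ⟨S3, hS3, hK3⟩ := StripTM.kraft_ge_at (l := 3) (r0 := 40) (by norm_num) hq (2 ^ 64) 81
  obtain ⟨S4, hS4, hK4⟩ := StripTM.kraft_ge_at (l := 4) (r0 := 40) (by norm_num) hq (2 ^ 64) 81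
  obtain ⟨S5, hS5, hK5⟩ := StripTM.kraft_ge_at (l := 5) (r0 := 40) (by norm_num) hq (2 ^ 64) 81
  set U := spanOneFamily ∪ S2 ∪ S3 ∪ S4 ∪ S5 with hU
  have hadm : Renewal.Admissible U := by
    intro s hs
    simp only [hU, mem_union] at hs
    rcases hs with (((h | h) | h) | h) | h
    · exact (spanOneFamily_spec s h).1
    · exact (hS2 s h).1
    · exact (hS3 s h).1
    · exact (hS4 s h).1
    · exact (hS5 s h).1
  have h0 : [(0 : Step)] ∈ U := by
    simp only [hU, mem_union]
    exact Or.inl (Or.inl (Or.inl (Or.inl nil_cons_mem_spanOneFamily)))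
  -- the tilted Kraft sum splits over the spans
  have hx1 : ∀ s ∈ spanOneFamily, xEnd s < 2 := fun s hs => by rw [(spanOneFamily_spec s hs).2]; norm_num
  have hx2 : ∀ s ∈ spanOneFamily ∪ S2, xEnd s < 3 := fun s hs => by
    rcases mem_union.1 hs with h | h; linarith [hx1 s h]; rw [(hS2 s h).2]; norm_num
  have hx3 : ∀ s ∈ spanOneFamily ∪ S2 ∪ S3, xEnd s < 4 := fun s hs => by
    rcases mem_union.1 hs with h | h; linarith [hx2 s h]; rw [(hS3 s h).2]; norm_num
  have hx4 : ∀ s ∈ spanOneFamily ∪ S2 ∪ S3 ∪ S4, xEnd s < 5 := fun s hs => by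
    rcases mem_union.1 hs with h | h; linarith [hx3 s h]; rw [(hS4 s h).2]; norm_num
  set f : List Step → ℝ := fun s => (347 / 1250 : ℝ) ^ s.length * (2 : ℝ) ^ (xEnd s).toNat with hf
  have hsum : ∑ s ∈ U, f s = ∑ s ∈ spanOneFamily, f s + ∑ s ∈ S2, f s + ∑ s ∈ S3, f s + ∑ s ∈ S4, f s +
      ∑ s ∈ S5, f s := by
    rw [hU, sum_union_of_xEnd' hx4 (fun s h => by exact_mod_cast (hS5 s h).2),
      sum_union_of_xEnd' hx3 (fun s h => by exact_mod_cast (hS4 s h).2),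
      sum_union_of_xEnd' hx2 (fun s h => by exact_mod_cast (hS3 s h).2),
      sum_union_of_xEnd' hx1 (fun s h => by exact_mod_cast (hS2 s h).2)]
  -- on `S_l` the weight is `2^l · x^{|s|}`
  have hSl : ∀ (l : ℕ) (Sl : Finset (List Step)), (∀ s ∈ Sl, IsIrrBridge s ∧ xEnd s = l) →
      ∑ s ∈ Sl, f s = (2 : ℝ) ^ l * ∑ s ∈ Sl, ((347 : ℕ) / (1250 : ℕ) : ℝ) ^ s.length := by
    intro l Sl hSl
    rw [Finset.mul_sum]
    refine Finset.sum_congr rfl fun s hs => ?_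
    rw [hf]; simp only
    rw [(hSl s hs).2, Int.toNat_natCast]
    push_cast; ring
  have hK : (1 : ℝ) ≤ ∑ s ∈ U, f s := by
    rw [hsum, hSl 2 S2 hS2, hSl 3 S3 hS3, hSl 4 S4 hS4, hSl 5 S5 hS5, hf]
    simp only
    rw [tiltedKraft_spanOneFamily]
    have e1 : ((347 : ℕ) / (1250 : ℕ) : ℝ) = 347 / 1250 := by norm_num
    have hS : (((2 : ℕ) ^ 64 : ℕ) : ℝ) = (2 : ℝ) ^ 64 := by norm_num
    rw [hS, e1] at hK2 hK3 hK4 hK5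
    rw [e1]
    have hpos : (0 : ℝ) < 2 ^ 64 := by positivity
    have hV := dpAt_values_3602_tilted
    have hTot1 : (339339242946921756 : ℝ) ≤ 2 ^ 64 * ((2 : ℝ) ^ 2 * ∑ s ∈ S2, (347 / 1250 : ℝ) ^ s.length +
        (2 : ℝ) ^ 3 * ∑ s ∈ S3, (347 / 1250 : ℝ) ^ s.length + (2 : ℝ) ^ 4 * ∑ s ∈ S4, (347 / 1250 : ℝ) ^ s.length +
        (2 : ℝ) ^ 5 * ∑ s ∈ S5, (347 / 1250 : ℝ) ^ s.length) := by
      rw [← hV]; nlinarith [hK2, hK3, hK4, hK5]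
    have hTot2 : (339339242946921756 : ℝ) / 2 ^ 64 ≤ (2 : ℝ) ^ 2 * ∑ s ∈ S2, (347 / 1250 : ℝ) ^ s.length +
        (2 : ℝ) ^ 3 * ∑ s ∈ S3, (347 / 1250 : ℝ) ^ s.length + (2 : ℝ) ^ 4 * ∑ s ∈ S4, (347 / 1250 : ℝ) ^ s.length +
        (2 : ℝ) ^ 5 * ∑ s ∈ S5, (347 / 1250 : ℝ) ^ s.length := by
      rw [div_le_iff₀' hpos]; exact hTot1
    have hnum := tiltedKraft_numeric_3602
    linarith
  obtain ⟨κ, hκ, h⟩ := Renewal.exists_mul_pow_le_pulledBridgeZ hadm h0 (x := 347 / 1250) (y := 2)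
    (by norm_num) (by norm_num) hK
  refine ⟨κ, hκ, fun N => ?_⟩
  have e : ((347 / 1250 : ℝ))⁻¹ = 1250 / 347 := by norm_num
  rw [← e]; exact h N

/-- **The enclosure at `y = 2`, sharp edition**: `κ·(1250/347)^N ≤ Z^B_N(2) ≤ Z_N(log 2) ≤ 2⁴¹·(7206013/2000000)^N`,
i.e. `3.602305 ≤ e^{λ_B(2)} ≤ e^{λ(2)} ≤ 3.6030065` whenever the limits exist.
[cite: Beaton2015, Theorem 1 and Lemma 2; PonitzTittmann2000, §3] -/
theorem pulled_enclosure_two_sharp :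
    ∃ κ : ℝ, 0 < κ ∧ ∀ N : ℕ,
      κ * (1250 / 347 : ℝ) ^ N ≤ Zd.pulledBridgeZ 2 N 2 ∧
        Zd.pulledBridgeZ 2 N 2 ≤ Zd.driftZ 2 N (Real.log 2) ∧
        Zd.driftZ 2 N (Real.log 2) ≤ 2 ^ 41 * (7206013 / 2000000 : ℝ) ^ N := by
  obtain ⟨κ, hκ, h⟩ := pulledBridgeZ_two_lower_sharp
  exact ⟨κ, hκ, fun N => ⟨h N, Zd.pulledBridgeZ_le_driftZ 2 N (by norm_num), driftZ_two_upper N⟩⟩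

end Literature.Probability.RandomPlanarGeometry.SAW

end
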